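import Mathlib
import HarnessLib
import HarnessLib.Audit
import Summits.ValiantsHypothesis.Statement
import HarnessLib.Audit.Status.Attr

/-!
Route: PartialSorting

DORMANT since 2026-08-22T03:19:43Z (reconciler: no traction for 5 d (last activity item-evidence-added at 2026-08-17T02:12:07Z); parked, not closed — `ledger route dormant route-ValiantsHypothesis-PartialSorting --off` to reactivate) — unstaffed, not closed; items shared with open routes are served there. `ledger route dormant <id> --off` reactivates.

# Route PartialSorting — partial sorting is harder than sorting — the cut-width-n/4 Bruhat
truncation of det_n is VNP-hard and not in VP; smooth truncations are dets

It suffices to show X (Target) := SOME rank-truncated determinant family is not in VP_ℂ: there is a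
sequence w = (w_n : Fin n → Fin n)
with (D_{w_n})_n ∉ VP, where D_w(X) := Σ_{σ ≤ w} sgn(σ) Π_a x_{a,σ(a)} and σ ≤ w is Bruhat order by
the Björner–Brenti rank criterion
σ[i,j] ≤ w[i,j], σ[i,j] := #{a ≤ i : σ(a) ≥ j} (BjornerBrenti2005 Thm 2.1.5; D_{w₀} = det_n, D_e =
x_11⋯x_nn). Every such family is in
VNP (item BruhatDetInVNP, Valiant's criterion), so X gives VNP_ℂ ⊄ VP_ℂ, i.e. VP_ℂ ≠ VNP_ℂ, by two
lines of logic. The concrete rung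
(cruxes) is ONE explicit truncation, new with this route: w⋆_n := reverse the first m and the last m
positions into each other
(w⋆(a) = n−1−a for a < m or a ≥ n−m, else a; m = ⌊n/4⌋; w⋆ = (1 n) for m = 1), whose Bruhat ideal is
EXACTLY the permutations of
CUT-WIDTH ≤ m: [e, w⋆] = {σ : d_t(σ) ≤ m ∀t}, d_t(σ) := #{a ≤ t : σ(a) > t} (item CutWidthIdeal;
brute-force checked n ≤ 8). So
CutDet_n := D_{w⋆_n} = Σ_{cut-width ≤ n/4} sgn σ x^σ interpolates x^{id} (m = 0) → det (m ≥ n/2)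
along the 0-Hecke sorting network;
crux PerProjectsToCutDet (per ≤_p CutDet, VNP-completeness) makes X ⇔ VH, crux CutDetNotVP is X for
w⋆. Card realised:
partial-sorting-bruhat-determinants (spine).
Lean: `∃ w : (n : ℕ) → Fin n → Fin n, ¬ Literature.Computability.AlgebraicComplexity.IsVPFamily (fun
n => ∑ σ : Equiv.Perm (Fin n), if (∀ i j : Fin n, (Finset.univ.filter (fun a : Fin n => a ≤ i ∧ j ≤
σ a)).card ≤ (Finset.univ.filter (fun a : Fin n => a ≤ i ∧ j ≤ (w n) a)).card) then Equiv.Perm.sign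
σ • ∏ a : Fin n, MvPolynomial.X (a, σ a) else (0 : MvPolynomial (Fin n × Fin n) ℂ))`

## Assembly
Pure logic over proved cone facts (sorry-free in Sketch.lean and glue.lean; axioms
propext/Classical.choice/Quot.sound): if VP ℂ = VNP ℂ,
pick the w of Target; BruhatDetInVNP w and the bundling bridge mem_VNP_ofFintype_iff_holds put
PolyFamily.ofFintype (D_{w_n})_n in
VNP ℂ = VP ℂ, and mem_VP_ofFintype_iff_holds makes it a VP family, contradicting Target. CutDetNotVP
→ Target by exhibiting w⋆
(target_of_cutDetNotVP in Sketch.lean, one line), which is what the Assembly item records;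
PerProjectsToCutDet is not a hypothesis
of `closes`: it upgrades Target/CutDetNotVP to X ⇔ VH (with isVNPComplete_perPoly_holds,
IsPProjection.trans_holds,
VP_eq_VNP_iff_isVPFamily_of_isVNPComplete).

Rationale: WHY THIS LINE. Verma–Norton–Stembridge telescoping (BjornerBrenti2005 Cor 2.7.10;
doi:10.1007/s10801-006-0027-2; doi:10.1017/s1446788700012453) reads
det = product-state amplitude of the FULL adjacent sorting network of idempotent 0-Hecke gates
Π(1−π_s) and D_w = a PARTIAL network, one
gate per weak-order cover (item HeckeStep, machine-checked n ≤ 5 here): VP ∋ x^{id}, det sit at both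
ends and the question "where is
VNP-hardness born when comparators are deleted from bubble sort" has exact structure —
smooth/Gasharov–Reiner truncations are single
determinants on a board (doi:10.1016/j.jcta.2007.01.001, arXiv:2002.07851 Cor 2.6; item
SmoothIsBoard), bounded cut-width truncations are
VP by a transfer-matrix DP over (missing values, pending values) (item BoundedWidthInVP; this
session's observation, which also shows
the card's parameter e(w) = #essential conditions is the WRONG dichotomy parameter: D_{(1 n)} has e
= n−3 yet is VP), and the first
family with both many essential rank conditions (2m−1, an antichain) and large rank budget (m = n/4)
is CutDet, a box-coefficient
extraction Σ_{c ∈ [0,m]^{2m−1}} [s^c] det(x_ab Π_{a≤t<b} s_t) from ONE torus-weighted determinant.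
Imported: Coxeter/Bruhat
combinatorics (rank criterion, lifting property, pattern characterisations of Bruhat ideals:
Sjöstrand, Hultman
doi:10.1016/j.jcta.2011.04.005), Valiant's completeness/criterion technology (Valiant1979,
Burgisser2000; in tree:
isVNPComplete_perPoly_holds, isVNPFamily_circuitSum), the immanant-dichotomy template of the
CHARACTER axis (Hartmann1985,
Burgisser2000Immanants, Curticapean2021) transplanted to the Bruhat/KL axis where weights
(−1)^ℓ(σ)[σ ≤ w] are not class functions.
No route of this summit truncates the permutation sum by Bruhat order (56 Theses files grepped;
FifoMatching restricts MATCHINGS by an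
order pattern and is the structural sibling); negatives index (ElusiveCandidate 0340, OptimalUnique
3735/3738) untouched.

RANKED CRUXES. #0 Target (target) — some rank-truncated determinant family is hard: there is w =
(w_n : Fin n → Fin n)_n with (D_{w_n})_n = (Σ_{σ ≤ w_n} sgn σ x^σ)_n not a VP family over ℂ (σ ≤ w
by the rank criterion; for non-bijective w_n the truncation set is still a Bruhat lower set). (why
it might fail: ¬Target says every partial 0-Hecke sorting network is classically contractible; with
PerProjectsToCutDet that is VP = VNP, so Target is exactly as safe as VH once completeness lands,
and strictly weaker information before.) [BjornerBrenti2005, Valiant1979, Burgisser2000,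
doi:10.1016/j.jcta.2007.01.001]
#2 PerProjectsToCutDet (crux) — the permanent family is a p-projection of the cut-width truncation:
per_k = CutDet_{t(k)}(x ↦ {constants} ∪ {y_ij}) with t p-bounded, CutDet_n := D_{w⋆_n} = Σ_{σ ∈ S_n,
d_t(σ) ≤ ⌊n/4⌋ ∀t} sgn σ Π x_{aσ(a)} (card K1 made explicit). With BruhatDetInVNP, Valiant's theorem
(isVNPComplete_perPoly_holds) and IsPProjection.trans_holds this is VNP-completeness of CutDet and
upgrades Target to an equivalent of VH. Reduction available: saturating m−c of the budget with
forced outer arcs projects CutDet_n onto the width-c truncation of the middle window of size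
n−2m+2c, so it suffices to embed per_k sign-coherently into SOME width-c(k) truncation with c,
window poly(k) (c ≥ k/(C log k) forced by BoundedWidthInVP unless per has small circuits). [deps:
CutWidthIdeal, BruhatDetInVNP] [difficulty: XL] (why it might fail: every permutation of bandwidth ≤
m is in the ideal untouched, so a gadget sees truncation only at the budget boundary d_t = m; Verma
balance (each Bruhat interval is Eulerian) may cancel exactly the sign-coherent surplus a per-gadget
needs — CutDet could be VNP-intermediate.) [Valiant1979, Burgisser2000, BjornerBrenti2005,
Curticapean2021, HrubesJoglekar2025]
#3 CutDetNotVP (crux) — the cut-width-⌊n/4⌋ truncated determinant CutDet_n = D_{w⋆_n} = Σ_{σ : #{a ≤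
t : σ(a) > t} ≤ ⌊n/4⌋ ∀t} sgn σ Π_a x_{a σ(a)} is not a VP family over ℂ (Target for the explicit
w⋆; "deleting the comparators outside the outer m layers of bubble sort makes the amplitude hard").
[deps: CutWidthIdeal] [difficulty: open-problem] (why it might fail: the two known algorithms (box
interpolation in 2m−1 torus weights, (m+1)^(2m−1) points; cut DP, n^O(m) states) are both
exponential at m = n/4, but a clow-sequence/Gaussian-elimination analogue respecting the ℓ^∞ cut
profile, or a Dodgson-type identity for Σ_(d ≤ b) sgn σ x^σ, would put it in VP.) [Valiant1979,
Burgisser2000, BjornerBrenti2005, doi:10.4086/cjtcs.1997.005, doi:10.1016/j.laa.2008.10.029]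
#9 BruhatDetInVNP (support) — for EVERY sequence w = (w_n : Fin n → Fin n), (D_{w_n})_n is a VNP
family over ℂ: coefficients sgn(σ)·[σ ≤ w_n] ∈ {0,±1}, the rank test is a polynomial-size B₂-circuit
in the 0/1 matrix of σ (w_n is advice; VNP is non-uniform), so D = F⁺ − F⁻ with F^± =
isVNPFamily_circuitSum instances (even/odd σ), and VNP is closed under difference (one extra Boolean
variable, padded witnesses) and renaming Fin(n²) ≃ Fin n × Fin n (isVNPFamily_renameEquiv_iff).
Needed by the deciding theorem. [difficulty: provable-now] [Valiant1979, Burgisser2000,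
BjornerBrenti2005]
#9 CutWidthIdeal (support) — the Bruhat ideal of w⋆_n (reverse the first ⌊n/4⌋ and last ⌊n/4⌋
positions into each other, identity in between) is exactly the set of permutations of cut-width ≤
⌊n/4⌋: for all σ ∈ S_n, (∀ i j, σ[i,j] ≤ w⋆[i,j]) ↔ ∀ t, #{a ≤ t : σ(a) > t} ≤ ⌊n/4⌋. Proof on
paper: w⋆[i,j] is maximal (= min(i+1, n−j)) except on the rows m ≤ i < n−m where the binding entries
are w⋆[t,t+1] = m, and σ[i,j] ≤ σ[i,i+1] for j > i, σ[i,j] − (i−j+1) ≤ σ[i,i+1] for j ≤ i (BB Thm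
2.1.5); brute-force verified for n ≤ 8 (scratch/bruhat_check.py). Grounds that CutDet is literally a
Bruhat-truncated determinant D_w. [difficulty: provable-now] [BjornerBrenti2005,
doi:10.1016/j.jcta.2011.04.005]
#9 BoundedWidthInVP (support) — for every constant c, the width-c truncated determinant family (Σ_{σ
∈ S_n : #{a ≤ t : σ(a) > t} ≤ c ∀t} sgn σ x^σ)_n is in VP: scan positions a = 1..n choosing σ(a);
the state at cut t is (M_t, U_t) = (values ≤ t not yet used, values > t already used), |M_t| = |U_t|
= d_t ≤ c, at most (c+1)·n^(2c) states; the weight x_{aσ(a)} and the sign increment #{a' < a : σ(a')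
> σ(a)} = #{u ∈ U : u > v} + [v ∈ M]((a−1−v) − #{b ∈ M : b > v}) are state-computable, so an ABP of
width n^O(c) computes it (complexity_add_le/mul_le/finset_sum). c = 1 is D_{(1 n)} (|ideal| =
1,2,6,20,68,232,792,2704, a = 4a'−2a''), the first deleted-comparator family; this is the solved low
end of the width axis and the counterexample to "many essential conditions ⇒ hard". [difficulty:
provable-now] [BjornerBrenti2005, doi:10.1016/j.laa.2008.10.029, Burgisser2000]
#9 HeckeStep (support) — ONE GATE PER COVER (card F1/P1, the 0-Hecke factorisation as a polynomial
identity): if w(k) < w(k+1) then D_{w·s_k} = Σ_{u ≤ w, u(k) < u(k+1)} sgn(u)·(x^u − x^{u s_k}) — the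
gate 1 − π_{s_k} kills descents and antisymmetrises ascents in rows k, k+1; iterating along a
reduced word gives D_w from x^{id} and det from the full bubble-sorting network. Proof: [e, ws] =
[e,w] ∪ [e,w]s with u ≤ ws ⇔ (u ≤ w if u < us; us ≤ w if us < u) (lifting property, BB Prop 2.2.7,
from the rank criterion: (ws)[i,j] = w[i,j] + [i = k][w(k) < j ≤ w(k+1)]); machine-checked for all
(w,k), n ≤ 5. [difficulty: provable-now] [BjornerBrenti2005, doi:10.1007/s10801-006-0027-2,
doi:10.1017/s1446788700012453]
#9 SmoothIsBoard (support) — SMOOTH ONES ARE DETS (Sjöstrand 2007 / Gasharov–Reiner "defined by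
inclusions", card F2): if w ∈ S_n avoids 4231, 35142, 42513 and 351624 then [e,w] is a board: there
is B ⊆ [n]×[n] with σ ≤ w ⇔ ∀a, (a,σ(a)) ∈ B; hence D_w = det(X·1_B) is a projection of det_n and in
VP (isVPFamily_detPoly_holds). Brute force (n ≤ 6): board ⇔ avoidance, 0 mismatches,
1,2,6,23,101,477 boards. Only the direction used by the line is filed. [difficulty: L]
[doi:10.1016/j.jcta.2007.01.001, doi:10.1016/j.jcta.2011.04.005, arXiv:2002.07851,
BjornerBrenti2005]

TWO-LAYER PLAN. Foreseen glued splits, none filed now (k ≤ 3, depth 1). PerProjectsToCutDet ⇐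
WindowReduction (CutDet_n projects onto the width-c
truncation of its middle window of size n−2m+2c for every c ≤ m: saturate the budget with m−c forced
outer arcs; provable bookkeeping)
→ SignCoherentWidthGadget (per_k is a projection of SOME width-c(k) truncated determinant with c,
size poly(k): the real content; first
target an iff-coupling gadget living on the budget boundary d_t = c, Valiant/Hrubeš–Joglekar style
signed absorbers) → PerProjectsToCutDet.
BruhatDetInVNP ⇐ VNPClosedUnderSub (IsVNPFamily f → IsVNPFamily g → IsVNPFamily (f − g), padded
Boolean blocks) → RankTestCircuit
(a poly-size B₂ circuit deciding "e is the graph of a permutation σ with σ[i,j] ≤ w[i,j] ∀ i,j and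
sgn σ = ±1") → BruhatDetInVNP.
CutDetNotVP: no split until a handle exists; the only honest children would be restricted-model
rungs (read-k determinantal
representations à la HrubesJoglekar2025, ABP width in the position order = the DP is tight?) filed
as support, never as its proof.

KILL CRITERIA. CutDetNotVP refuted (IsVPFamily CutDet proved — a polynomial-size circuit for the
width-n/4 truncation) closes the concrete rung: if the
algorithm is specific to w⋆ (uses the interval structure of the cut conditions) pivot Target to the
grid family π[D_m^k] with a k×k
antichain of essential rectangles (restate CutDetNotVP for it, rank 3); if it handles every
box-truncation Σ_{c ≤ b}[s^c]det(X∘S) of a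
torus-weighted determinant, Target itself is dead for all rank truncations — close
`refuted:CutDetNotVP` with the census "partial
sorting networks are contractible" (a structural theorem worth recording: poly-time KL-immanant /
Bruhat-ideal evaluation, new
total-positivity tests). PerProjectsToCutDet refuted (¬ per ≤_p CutDet) does NOT kill: Target still
implies VH; drop it with a note and
re-rank (VNP-intermediate candidate). A support item refuted = my combinatorics is wrong:
CutWidthIdeal/HeckeStep/SmoothIsBoard are
brute-force checked (n ≤ 8/5/6), restate with the corrected indexing. per ∉ VP proved elsewhere
moots the assembly, not the line.

NOT DECOMPOSED YET. The general upper-bound theory — F3 of the card (L(D_w) ≤ n^O(e(w)) by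
interpolation in one weight per essential rectangle) and its
width refinement (L(D_w) ≤ n^O(max_t w[t,t+1]) by the DP) and the right JOINT parameter (neither
e(w) nor width alone: det has width
n/2, D_(1 n) has e = n−3, both VP) — needs essential-set / Fulton-diagram vocabulary Lean lacks;
only the two instances SmoothIsBoard and
BoundedWidthInVP are filed. The unsigned twin P_w = Σ_{σ≤w} x^σ (card K3) is TRIVIAL on this family
(per_k = CutPer_n restricted to a
diagonal k-block once ⌊n/4⌋ ≥ k/2, while the same restriction of CutDet gives det_k) — recorded as
the calibration "signs, not truncation,
carry the difficulty", not filed. The grid family π[D_m^k] (coarse transport plans Bruhat-dominated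
by m·P_π), the 4231[I_m^4] candidate
of the card (its ideal is {cut-width ≤ m} ∩ {|σ(a)−a| ≤ 3m}, checked n = 4, 8 — w⋆ is the cleaner
generator), the Pfaffian/hafnian twin
on fixed-point-free involutions (card P3), #P- /⊕P-hardness of counting width-bounded permutations of
a bipartite graph (Boolean shadow;
machine-level reductions not provable in tree yet), VQP-membership of the width-log n truncation (DP
gives n^O(log n): a natural
VNP-intermediate candidate if VNP ⊄ VQP), definitions bruhatLE/bruhatDet as Literature notions
(items inline the sums so nothing waits).

CHEAPEST FALSIFIER. (1) Lookup, minutes: any complexity result for Kazhdan–Lusztig / Temperley–Lieb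
immanants or Bruhat-ideal sums (searched crossref
"Kazhdan-Lusztig immanant complexity", "Temperley-Lieb immanants", "complexity of immanants
dichotomy": only the CHARACTER axis —
Hartmann1985, Burgisser2000Immanants, Curticapean2021, Miklós–Riener 2023 — and positivity papers; a
hit "KL immanants in P" kills
Target for upper intervals at once). (2) kit, an hour: for n = 8, m = 2 (25 668 of 40 320 terms) fit
CutDet_8 as det of a single N×N
matrix over {0, ±x_ab} for N ≤ 12 and compute its ABP width profile in the best of 10⁴ random
variable orders versus det_8; a small
single-determinant expression for the first genuinely two-sided instance is the one cheap event that
threatens CutDetNotVP. (3) SMT,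
minutes: is per_3 a projection of the width-2 truncation of size ≤ 9 (window form of
PerProjectsToCutDet with c = 2)? per_3 ≤ det_7 ≤
CutDet_16 exists trivially (Grenet), so only c·window growth is informative; no solution up to size
9 says gadgets need c ≥ 3 already for
k = 3. Not run here: hub compute-free, one-shot plancard seat; the combinatorial supports WERE
brute-forced locally (n ≤ 8).

NUMBERS. |[e,w⋆]| = |{cut-width ≤ m}|: m = 1: 1, 2, 6, 20, 68, 232, 792, 2704 (n = 1..8; a_n =
4a_(n−1) − 2a_(n−2), consistent with a bounded
transfer matrix); n = 6, 7, 8 with m = 2: 684, 4140, 25 668; 4231[I_2^4]: 21 148 of 40 320. Board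
ideals = pattern avoiders: 1, 2, 6, 23,
101, 477 (n ≤ 6). Upper bounds: box interpolation (m+1)^(2m−1)·poly, cut DP (c+1)n^(2c)·poly; at m =
n/4 both exponential. Essential
conditions of w⋆_m: 2m−1 = n/2 − 1, pairwise incomparable, each with budget m. Known dichotomy on
the character axis for comparison:
immanants with n − λ₁ = O(1) in VP (Hartmann1985), n − λ₁ ≥ n^ε VNP-complete (Curticapean2021).
Items at open: 9 (2 cruxes, 1 target,
5 support, 1 assembly).

DEFINITION REQUESTS. After open (nothing waits on them; all items inline the sums): `bruhatLE` on
`Fin n → Fin n` by the rank criterion (BjornerBrenti2005 Thm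
2.1.5) with API (equivalence with the subword/transposition definition, lifting property, d_t =
σ[t,t+1], antiautomorphisms σ ↦ σw₀,
w₀σ, σ⁻¹), `bruhatDet n w`, `bruhatPer n w : MvPolynomial (Fin n × Fin n) k` (any CommRing k; eval
at w₀ = det, at e = diagonal
monomial, map under ring homs), `cutWidth σ` — topic Literature/Combinatorics/Coxeter for the order,
Summits/ValiantsHypothesis/
ValiantsHypothesis/Theorems for the polynomials (new objects posited for this problem). Mathlib has
CoxeterSystem length/inversions
but no Bruhat order (lean search 'Bruhat' --decl: only Choquet-Bruhat / Schwartz–Bruhat /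
IsBruhatFunction).

Novelty: Searches (2026-08-15): `lit search --source crossref "Kazhdan-Lusztig immanant complexity"` (10: KL
theory, Donten-Bury–Escobar–Portakal
torus-action complexity of KL VARIETIES — unrelated meaning); `… "complexity of immanants dichotomy
VNP-complete"` (Burgisser2000Immanants,
Hartmann1985, Ikenmeyer–Sanyal 2022 — character axis); `… "Temperley-Lieb immanants Kazhdan-Lusztig
immanants products of matrix
minors"` (doi:10.1016/j.jalgebra.2005.07.017, doi:10.1007/s00026-005-0268-0,
doi:10.4153/s0008414x21000262, doi:10.5802/alco.257,
Miklós–Riener doi:10.2139/ssrn.4429500 — positivity / character immanants on restricted matrices);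
`… "Bruhat interval rooks skew
Ferrers boards"` (doi:10.1016/j.jcta.2007.01.001); `… "Hultman inversion arrangements Bruhat
intervals"` (doi:10.1016/j.jcta.2011.04.005,
Gasharov doi:10.1006/jcta.1997.2861); `… "computing the permanent of band matrices"`
(doi:10.1016/j.laa.2008.10.029 banded Toeplitz
permanents, Barvinok 2015); `lit galaxy search "Bruhat order determinant" --star all` (0 rows); `lit
galaxy search "defined by
inclusions" --star all` (21 rows: Hultman invarr.pdf, Fink–Rajchgot–Sullivant arXiv:1510.04124
matrix Schubert varieties, Gilboa–Lapid
arXiv:1912.04725 smooth permutations, St. Dizier–Yong — none on circuits); `lit frontier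
ValiantsHypothesis --since 2022` (30 rows; only
doi:10.1016/j.tcs.2026.115862 "determinantal complexity of generalized permanents" is adjacent,
character/μ-type); `lean search Bruhat
--decl` (no Bruhat order); sea  [refs: 10.1016/j.jalgebra.2005.07.017, 10.1007/s00026-005-0268-0, 10.4153/s0008414x21000262, 10.5802/alco.257, 10.2139/ssrn.4429500, 10.1016/j.jcta.2007.01.001, 10.1016/j.jcta.2011.04.005, 10.1006/jcta.1997.2861, 10.1016/j.laa.2008.10.029, 10.1016/j.tcs.2026.115862, 1510.04124, 1912.04725, 2002.07851, doi:10.1016/j.jalgebra.2005.07.017, doi:10.1007/s00026-005-0268-0, doi:10.4153/s0008414x21000262, doi:10]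

Barriers (technique_class: new-vnp-family, coxeter-combinatorics, coefficient-extraction): - technique_class: new-vnp-family, coxeter-combinatorics, coefficient-extraction
- Literature.Barriers.ValiantsHypothesis.PermanentCharTwo: CutDet ≡ CutPer (mod 2) and CutPer is
trivially per-hard, so nothing here is characteristic-free; all items are over ℂ and
PerProjectsToCutDet uses signs essentially (sign-coherent gadgets), exactly as Valiant's
per-completeness does — conceded by design: the axis separates the signed from the unsigned side.
- Literature.Barriers.ValiantsHypothesis.PartialDerivativesDetPerm: not engaged — no
partial-derivative or flattening measure is proposed (they agree on det, per and every D_w with full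
support pattern); the route supplies a target family, an exact factorisation and upper bounds, not a
lower-bound technique.
- Literature.Barriers.ValiantsHypothesis.FullRankMultilinear: conceded and instructive — CutDet is
set-multilinear in rows like det, and Raz-type rank measures are already maximal for det ∈ VP, so no
coefficient-matrix rank separates CutDet from det; CutDetNotVP's bet is on the ORDER structure
(which comparators are missing), which rank cannot see; no rank rung is filed.
- Literature.Barriers.ValiantsHypothesis.RankMethods: same remark (and for the rank-lifting frames
of RankLiftingBarrier.lean); no sub-additive, lifted or flattened rank measure is used anywhere in
the route.
- Literature.Barriers.ValiantsHypothesis.AlgebraicNaturalProofs: not engaged — a candidate hard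
FAMILY and a completeness reduction, no distinguisher / natur

History (route lifecycle, newest last):
- 2026-08-16T04:21:27Z · AUTO-CRUX (backfill): Target — hypotheses of the deciding theorem that nothing in the route derives are cruxes (operator:999:1085951)
- 2026-08-22T03:19:43Z · DORMANT — reconciler: no traction for 5 d (last activity item-evidence-added at 2026-08-17T02:12:07Z); parked, not closed — `ledger route dormant route-ValiantsHypothesis (operator:999:4080383)

sub-problem: ValiantsHypothesis · status: dormant · opened planner-plancard-ValiantsHypothesis-ValiantsH-c39806ff-0 2026-08-15T19:25:52Z · rev 2 · ledger route-ValiantsHypothesis-PartialSorting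
GENERATED by the gate from the ledger (D-0016/17). Provers cite these decls: `theorem foo : Summit.ValiantsHypothesis.ValiantsHypothesis.Theses.PartialSorting.<Decl> := …` in Summits/ValiantsHypothesis/ValiantsHypothesis/Theorems/<Name>.lean.
-/

namespace Summit.ValiantsHypothesis.ValiantsHypothesis.Theses.PartialSorting

open scoped BigOperators Topology Manifold Classical MeasureTheory ProbabilityTheory Matrix InnerProductSpace ComplexConjugate ContinuousMap
open Filter Set Function TopologicalSpace MeasureTheory

attribute [summit_statement] _root_.ValiantsHypothesis

open Literature.PNP

/-- item stmt-ValiantsHypothesis-13590 · crux (kind.auto-crux: conjecture-grade) · rank 0 · open · by planner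
why it might fail: ¬Target says every partial 0-Hecke sorting network is classically contractible; with PerProjectsToCutDet that is VP = VNP, so Target is exactly as safe as VH once completeness lands, and strictly weaker information before.
sources: BjornerBrenti2005, Valiant1979, Burgisser2000, doi:10.1016/j.jcta.2007.01.001
[target] some rank-truncated determinant family is hard: there is w = (w_n : Fin n → Fin n)_n with
(D_{w_n})_n = (Σ_{σ ≤ w_n} sgn σ x^σ)_n not a VP family over ℂ (σ ≤ w by the rank criterion; for
non-bijective w_n the truncation set is still a Bruhat lower set). -/
@[route_item "route-ValiantsHypothesis-PartialSorting", crux]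
def Target : Prop :=
  ∃ w : (n : ℕ) → Fin n → Fin n, ¬ Literature.Computability.AlgebraicComplexity.IsVPFamily (fun n => ∑ σ : Equiv.Perm (Fin n), if (∀ i j : Fin n, (Finset.univ.filter (fun a : Fin n => a ≤ i ∧ j ≤ σ a)).card ≤ (Finset.univ.filter (fun a : Fin n => a ≤ i ∧ j ≤ (w n) a)).card) then Equiv.Perm.sign σ • ∏ a : Fin n, MvPolynomial.X (a, σ a) else (0 : MvPolynomial (Fin n × Fin n) ℂ))

/-- item stmt-ValiantsHypothesis-13591 · crux · rank 2 · open · by planner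
why it might fail: every permutation of bandwidth ≤ m is in the ideal untouched, so a gadget sees truncation only at the budget boundary d_t = m; Verma balance (each Bruhat interval is Eulerian) may cancel exactly the sign-coherent surplus a per-gadget needs — CutDet could be VNP-intermediate.
sources: Valiant1979, Burgisser2000, BjornerBrenti2005, Curticapean2021, HrubesJoglekar2025
[crux] the permanent family is a p-projection of the cut-width truncation: per_k = CutDet_{t(k)}(x ↦
{constants} ∪ {y_ij}) with t p-bounded, CutDet_n := D_{w⋆_n} = Σ_{σ ∈ S_n, d_t(σ) ≤ ⌊n/4⌋ ∀t} sgn σ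
Π x_{aσ(a)} (card K1 made explicit). With BruhatDetInVNP, Valiant's theorem
(isVNPComplete_perPoly_holds) and IsPProjection.trans_holds this is VNP-completeness of CutDet and
upgrades Target to an equivalent of VH. Reduction available: saturating m−c of the budget with
forced outer arcs projects CutDet_n onto the width-c truncation of the middle window of size
n−2m+2c, so it suffices to embed per_k sign-coherently into SOME width-c(k) truncation with c,
window poly(k) (c ≥ k/(C log k) forced by BoundedWidthInVP unless per has small circuits). [deps:
CutWidthIdeal, BruhatDetInVNP] [difficulty: XL] -/
@[route_item "route-ValiantsHypothesis-PartialSorting"]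
def PerProjectsToCutDet : Prop :=
  Literature.Computability.AlgebraicComplexity.IsPProjection (fun n => Literature.Computability.AlgebraicComplexity.perPoly (Fin n) ℂ) (fun n => ∑ σ : Equiv.Perm (Fin n), if (∀ i j : Fin n, (Finset.univ.filter (fun a : Fin n => a ≤ i ∧ j ≤ σ a)).card ≤ (Finset.univ.filter (fun a : Fin n => a ≤ i ∧ j ≤ (fun a : Fin n => if ((a : ℕ) < n / 4 ∨ n - n / 4 ≤ (a : ℕ)) then Fin.rev a else a) a)).card) then Equiv.Perm.sign σ • ∏ a : Fin n, MvPolynomial.X (a, σ a) else (0 : MvPolynomial (Fin n × Fin n) ℂ))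

/-- item stmt-ValiantsHypothesis-13592 · crux · rank 3 · open · by planner
why it might fail: the two known algorithms (box interpolation in 2m−1 torus weights, (m+1)^(2m−1) points; cut DP, n^O(m) states) are both exponential at m = n/4, but a clow-sequence/Gaussian-elimination analogue respecting the ℓ^∞ cut profile, or a Dodgson-type identity for Σ_(d ≤ b) sgn σ x^σ, would put it in VP.
sources: Valiant1979, Burgisser2000, BjornerBrenti2005, doi:10.4086/cjtcs.1997.005, doi:10.1016/j.laa.2008.10.029
[crux] the cut-width-⌊n/4⌋ truncated determinant CutDet_n = D_{w⋆_n} = Σ_{σ : #{a ≤ t : σ(a) > t} ≤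
⌊n/4⌋ ∀t} sgn σ Π_a x_{a σ(a)} is not a VP family over ℂ (Target for the explicit w⋆; "deleting the
comparators outside the outer m layers of bubble sort makes the amplitude hard"). [deps:
CutWidthIdeal] [difficulty: open-problem] -/
@[route_item "route-ValiantsHypothesis-PartialSorting"]
def CutDetNotVP : Prop :=
  ¬ Literature.Computability.AlgebraicComplexity.IsVPFamily (fun n => ∑ σ : Equiv.Perm (Fin n), if (∀ i j : Fin n, (Finset.univ.filter (fun a : Fin n => a ≤ i ∧ j ≤ σ a)).card ≤ (Finset.univ.filter (fun a : Fin n => a ≤ i ∧ j ≤ (fun a : Fin n => if ((a : ℕ) < n / 4 ∨ n - n / 4 ≤ (a : ℕ)) then Fin.rev a else a) a)).card) then Equiv.Perm.sign σ • ∏ a : Fin n, MvPolynomial.X (a, σ a) else (0 : MvPolynomial (Fin n × Fin n) ℂ))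

/-- item stmt-ValiantsHypothesis-13593 · support · rank 9 · closed · proved by Summit.ValiantsHypothesis.ValiantsHypothesis.Theorems.bruhatDetInVNP_proof @ 25ce7c9ff26a (prover) · by planner
sources: Valiant1979, Burgisser2000, BjornerBrenti2005
[support] for EVERY sequence w = (w_n : Fin n → Fin n), (D_{w_n})_n is a VNP family over ℂ:
coefficients sgn(σ)·[σ ≤ w_n] ∈ {0,±1}, the rank test is a polynomial-size B₂-circuit in the 0/1
matrix of σ (w_n is advice; VNP is non-uniform), so D = F⁺ − F⁻ with F^± = isVNPFamily_circuitSum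
instances (even/odd σ), and VNP is closed under difference (one extra Boolean variable, padded
witnesses) and renaming Fin(n²) ≃ Fin n × Fin n (isVNPFamily_renameEquiv_iff). Needed by the
deciding theorem. [difficulty: provable-now] -/
@[route_item "route-ValiantsHypothesis-PartialSorting", crux]
def BruhatDetInVNP : Prop :=
  ∀ w : (n : ℕ) → Fin n → Fin n, Literature.Computability.AlgebraicComplexity.IsVNPFamily (fun n => ∑ σ : Equiv.Perm (Fin n), if (∀ i j : Fin n, (Finset.univ.filter (fun a : Fin n => a ≤ i ∧ j ≤ σ a)).card ≤ (Finset.univ.filter (fun a : Fin n => a ≤ i ∧ j ≤ (w n) a)).card) then Equiv.Perm.sign σ • ∏ a : Fin n, MvPolynomial.X (a, σ a) else (0 : MvPolynomial (Fin n × Fin n) ℂ))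

/-- item stmt-ValiantsHypothesis-13594 · support · rank 9 · closed · proved by Summit.ValiantsHypothesis.Theorems.cutWidthIdeal_proof @ c14a8a3a9642 (prover) · by planner
sources: BjornerBrenti2005, doi:10.1016/j.jcta.2011.04.005
[support] the Bruhat ideal of w⋆_n (reverse the first ⌊n/4⌋ and last ⌊n/4⌋ positions into each
other, identity in between) is exactly the set of permutations of cut-width ≤ ⌊n/4⌋: for all σ ∈
S_n, (∀ i j, σ[i,j] ≤ w⋆[i,j]) ↔ ∀ t, #{a ≤ t : σ(a) > t} ≤ ⌊n/4⌋. Proof on paper: w⋆[i,j] is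
maximal (= min(i+1, n−j)) except on the rows m ≤ i < n−m where the binding entries are w⋆[t,t+1] =
m, and σ[i,j] ≤ σ[i,i+1] for j > i, σ[i,j] − (i−j+1) ≤ σ[i,i+1] for j ≤ i (BB Thm 2.1.5);
brute-force verified for n ≤ 8 (scratch/bruhat_check.py). Grounds that CutDet is literally a
Bruhat-truncated determinant D_w. [difficulty: provable-now] -/
@[route_item "route-ValiantsHypothesis-PartialSorting"]
def CutWidthIdeal : Prop :=
  ∀ (n : ℕ) (σ : Equiv.Perm (Fin n)), (∀ i j : Fin n, (Finset.univ.filter (fun a : Fin n => a ≤ i ∧ j ≤ σ a)).card ≤ (Finset.univ.filter (fun a : Fin n => a ≤ i ∧ j ≤ (fun a : Fin n => if ((a : ℕ) < n / 4 ∨ n - n / 4 ≤ (a : ℕ)) then Fin.rev a else a) a)).card) ↔ ∀ t : Fin n, (Finset.univ.filter (fun a : Fin n => a ≤ t ∧ t < σ a)).card ≤ n / 4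

/-- item stmt-ValiantsHypothesis-13595 · support · rank 9 · closed · proved by Summit.ValiantsHypothesis.ValiantsHypothesis.Theorems.boundedWidthInVP_proof (prover) · by planner
sources: BjornerBrenti2005, doi:10.1016/j.laa.2008.10.029, Burgisser2000
[support] for every constant c, the width-c truncated determinant family (Σ_{σ ∈ S_n : #{a ≤ t :
σ(a) > t} ≤ c ∀t} sgn σ x^σ)_n is in VP: scan positions a = 1..n choosing σ(a); the state at cut t
is (M_t, U_t) = (values ≤ t not yet used, values > t already used), |M_t| = |U_t| = d_t ≤ c, at most
(c+1)·n^(2c) states; the weight x_{aσ(a)} and the sign increment #{a' < a : σ(a') > σ(a)} = #{u ∈ U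
: u > v} + [v ∈ M]((a−1−v) − #{b ∈ M : b > v}) are state-computable, so an ABP of width n^O(c)
computes it (complexity_add_le/mul_le/finset_sum). c = 1 is D_{(1 n)} (|ideal| =
1,2,6,20,68,232,792,2704, a = 4a'−2a''), the first deleted-comparator family; this is the solved low
end of the width axis and the counterexample to "many essential conditions ⇒ hard". [difficulty:
provable-now] -/
@[route_item "route-ValiantsHypothesis-PartialSorting"]
def BoundedWidthInVP : Prop :=
  ∀ c : ℕ, Literature.Computability.AlgebraicComplexity.IsVPFamily (fun n => ∑ σ : Equiv.Perm (Fin n), if (∀ t : Fin n, (Finset.univ.filter (fun a : Fin n => a ≤ t ∧ t < σ a)).card ≤ c) then Equiv.Perm.sign σ • ∏ a : Fin n, MvPolynomial.X (a, σ a) else (0 : MvPolynomial (Fin n × Fin n) ℂ))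

/-- item stmt-ValiantsHypothesis-13596 · support · rank 9 · closed · proved by Summit.ValiantsHypothesis.ValiantsHypothesis.Theorems.PartialSortingHeckeStep.heckeStep_proof @ 186f42965963 (prover) · by planner
sources: BjornerBrenti2005, doi:10.1007/s10801-006-0027-2, doi:10.1017/s1446788700012453
[support] ONE GATE PER COVER (card F1/P1, the 0-Hecke factorisation as a polynomial identity): if
w(k) < w(k+1) then D_{w·s_k} = Σ_{u ≤ w, u(k) < u(k+1)} sgn(u)·(x^u − x^{u s_k}) — the gate 1 −
π_{s_k} kills descents and antisymmetrises ascents in rows k, k+1; iterating along a reduced word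
gives D_w from x^{id} and det from the full bubble-sorting network. Proof: [e, ws] = [e,w] ∪ [e,w]s
with u ≤ ws ⇔ (u ≤ w if u < us; us ≤ w if us < u) (lifting property, BB Prop 2.2.7, from the rank
criterion: (ws)[i,j] = w[i,j] + [i = k][w(k) < j ≤ w(k+1)]); machine-checked for all (w,k), n ≤ 5.
[difficulty: provable-now] -/
@[route_item "route-ValiantsHypothesis-PartialSorting"]
def HeckeStep : Prop :=
  ∀ (n : ℕ) (w : Equiv.Perm (Fin n)) (k : Fin n) (hk : (k : ℕ) + 1 < n), w k < w ⟨(k : ℕ) + 1, hk⟩ → (∑ σ : Equiv.Perm (Fin n), if (∀ i j : Fin n, (Finset.univ.filter (fun a : Fin n => a ≤ i ∧ j ≤ σ a)).card ≤ (Finset.univ.filter (fun a : Fin n => a ≤ i ∧ j ≤ (w * Equiv.swap k ⟨(k : ℕ) + 1, hk⟩) a)).card) then Equiv.Perm.sign σ • ∏ a : Fin n, MvPolynomial.X (a, σ a) else (0 : MvPolynomial (Fin n × Fin n) ℂ)) = ∑ u : Equiv.Perm (Fin n), if ((∀ i j : Fin n, (Finset.univ.filter (fun a : Fin n => a ≤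 i ∧ j ≤ u a)).card ≤ (Finset.univ.filter (fun a : Fin n => a ≤ i ∧ j ≤ w a)).card) ∧ u k < u ⟨(k : ℕ) + 1, hk⟩) then Equiv.Perm.sign u • (∏ a : Fin n, MvPolynomial.X (a, u a) - ∏ a : Fin n, MvPolynomial.X (a, u ((Equiv.swap k ⟨(k : ℕ) + 1, hk⟩) a))) else (0 : MvPolynomial (Fin n × Fin n) ℂ)

/-- item stmt-ValiantsHypothesis-13597 · support · rank 9 · closed · proved by Summit.ValiantsHypothesis.ValiantsHypothesis.Theorems.PartialSortingSmoothIsBoard.smoothIsBoard_proof @ 00a8cdd78641 (prover) · by planner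
sources: doi:10.1016/j.jcta.2007.01.001, doi:10.1016/j.jcta.2011.04.005, arXiv:2002.07851, BjornerBrenti2005
[support] SMOOTH ONES ARE DETS (Sjöstrand 2007 / Gasharov–Reiner "defined by inclusions", card F2):
if w ∈ S_n avoids 4231, 35142, 42513 and 351624 then [e,w] is a board: there is B ⊆ [n]×[n] with σ ≤
w ⇔ ∀a, (a,σ(a)) ∈ B; hence D_w = det(X·1_B) is a projection of det_n and in VP
(isVPFamily_detPoly_holds). Brute force (n ≤ 6): board ⇔ avoidance, 0 mismatches, 1,2,6,23,101,477
boards. Only the direction used by the line is filed. [difficulty: L] -/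
@[route_item "route-ValiantsHypothesis-PartialSorting"]
def SmoothIsBoard : Prop :=
  ∀ (n : ℕ) (w : Equiv.Perm (Fin n)), ¬ (∃ f : Fin 4 → Fin n, StrictMono f ∧ ∀ a b : Fin 4, ((![3, 1, 2, 0] : Fin 4 → ℕ) a < (![3, 1, 2, 0] : Fin 4 → ℕ) b ↔ w (f a) < w (f b))) → ¬ (∃ f : Fin 5 → Fin n, StrictMono f ∧ ∀ a b : Fin 5, ((![2, 4, 0, 3, 1] : Fin 5 → ℕ) a < (![2, 4, 0, 3, 1] : Fin 5 → ℕ) b ↔ w (f a) < w (f b))) → ¬ (∃ f : Fin 5 → Fin n, StrictMono f ∧ ∀ a b : Fin 5, ((![3, 1, 4, 0, 2] : Fin 5 → ℕ) a < (![3, 1, 4, 0, 2] : Fin 5 → ℕ) b ↔ w (f a) < w (f b))) → ¬ (∃ f : Fin 6 → Fin n, StrictMono f ∧ ∀ a b : Fin 6, ((![2, 4, 0, 5, 1, 3] : Fin 6 → ℕ) a < (![2, 4, 0, 5, 1, 3] : Fin 6 → ℕ) b ↔ w (f a) < w (f b))) → ∃ B : Finset (Fin n × Fin n), ∀ σ :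 Equiv.Perm (Fin n), (∀ i j : Fin n, (Finset.univ.filter (fun a : Fin n => a ≤ i ∧ j ≤ σ a)).card ≤ (Finset.univ.filter (fun a : Fin n => a ≤ i ∧ j ≤ w a)).card) ↔ ∀ a : Fin n, (a, σ a) ∈ B

/-- item stmt-ValiantsHypothesis-13598 · assembly · rank 1 · closed · proved by Summit.ValiantsHypothesis.ValiantsHypothesis.Theorems.PartialSortingAssembly.assembly_proof @ 19c6641fda3f (prover) · by planner
sources: Valiant1979, Burgisser2000
[assembly] CutDetNotVP → BruhatDetInVNP → VP_ℂ ≠ VNP_ℂ (via Target). -/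
@[route_item "route-ValiantsHypothesis-PartialSorting"]
def Assembly : Prop :=
  CutDetNotVP → BruhatDetInVNP → _root_.ValiantsHypothesis

/-! D-0027 §2.1 — DECIDING THEOREM (planner-authored via `route open/edit --closes-file`; by planner-plancard-ValiantsHypothesis-ValiantsH-c39806ff-0 2026-08-15T19:25:52Z):
its hypotheses are this route's items and its conclusion the sub-problem Statement (glue_lint), and it elaborates with this file. -/

/-- DECIDING THEOREM (D-0027 §2.1). `Target` (some rank-truncated determinant family
`D_{w_n} = Σ_{σ ≤ w_n} sgn σ · x^σ` is not a `VP` family over `ℂ`) and `BruhatDetInVNP` (every such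
family is in `VNP`, Valiant's criterion) give `VP_ℂ ≠ VNP_ℂ`: if `VP ℂ = VNP ℂ`, the bundled family
lies in `VNP ℂ` by `BruhatDetInVNP` and the bundling bridge `mem_VNP_ofFintype_iff_holds`, hence in
`VP ℂ`, and `mem_VP_ofFintype_iff_holds` makes it a `VP` family, contradicting `Target`.
(`CutDetNotVP → Target` by exhibiting `w⋆`, see `Assembly`.) Axioms: propext, Classical.choice, Quot.sound. -/
@[closes "route-ValiantsHypothesis-PartialSorting"] theorem closes (h_Target : Target) (h_BruhatDetInVNP : BruhatDetInVNP) : _root_.ValiantsHypothesis := by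
  show Literature.Computability.AlgebraicComplexity.VP ℂ ≠ Literature.Computability.AlgebraicComplexity.VNP ℂ
  intro hEq
  obtain ⟨w, hw⟩ := h_Target
  apply hw
  have hmem := (Literature.Computability.AlgebraicComplexity.mem_VNP_ofFintype_iff_holds _).2 (h_BruhatDetInVNP w)
  rw [← hEq] at hmem
  exact (Literature.Computability.AlgebraicComplexity.mem_VP_ofFintype_iff_holds _).1 hmem

end Summit.ValiantsHypothesis.ValiantsHypothesis.Theses.PartialSorting
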